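import Summits.HodgeConjecture.CorCM.Census.TypeStabiliserCyclicFactor

/-!
# The twisted cyclic-factor law (`Proposition Λ`): `𝒦` of `P·⟨g⟩` with `g² = z` central and `g p g⁻¹ ∈ {p, p z}`

COR-CM (cell `pub-hodgecm2`), count-neutral kernel combinatorics by the census seat lit-andre-3 (gen 22; lane TYPE-STABILISER-TWIST),
sequel of `Census/TypeStabiliserSquareRoots.lean` / `Census/TypeStabiliserCyclicFactor.lean`.  Pure group theory inside ONE ambient group
(internal formulation, nothing is constructed); theorems only (no definition, no `decide`, no certificate, no named fact, no `sorry`).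
HONEST FRAMING: `HC_CM` is NOT proved, here or anywhere in the tree; nothing here is a period or a headline.

THE LAW (memo `HOME/pub-hodgecm2-lit-andre-3/PORTFOLIO-lit-andre-3-g22.md` §7bis, «Proposition Λ»).  In a group `G` let `P ≤ G`, `g ∈ G` with
`z := g²` central, `z² = 1 ≠ z`, `g p g⁻¹ ∈ {p, p z}` for `p ∈ P` (the twist `λ(p) ∈ 𝔽₂`), every element of `G` of the form `p gⁱ`, and
`p gⁱ = 1 ⇒ gⁱ = 1` (`P ∩ ⟨g⟩ = 1`); let `c ∈ P` with `c² = 1 ≠ c`.  Then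

  **`𝒦(G, c) = (𝒦(P, c) ⊔ ⟨{q ∈ P | q² = c, g q = q g}⟩) ⊔ ⟨g⟩`**           (`stabGen_eq_of_twist`),

i.e. `G/𝒦(G,c) ≅ (P/𝒦(P,c)) / ⟨images of the square roots q of c with λ(q) = 0⟩`: the twist kills in `P/𝒦` exactly the square roots of `c`
lying in `ker λ` (for `λ = 0`, `G ≅ P × ℤ/4` and this is the square-root law).  Applied on paper to `P = P₁₂₈` (`P/𝒦 ≅ Q₈ × ℤ/2`) with `λ` the
projection to `ℤ/2` it yields the order-512 counterexample to «`Ω₁(G/𝒦)` cyclic or dihedral» (`G/𝒦 ≅ (ℤ/2)³`); nothing about that group is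
asserted here.  Mechanism: `g` and `q g` (`q² = c`, `g q = q g`, so `(qg)² = c z`) are not roots of `c`; a non-root `x = p gⁱ` of `c` has
`x² = p²` (i even, or i odd with `λ(p) = 1`) or `x⁴ = p⁴` with `g p = p g` (i odd, `λ(p) = 0`), whence `c ∉ ⟨p²⟩` resp. `c ∉ ⟨p⁴⟩`, and the
power criteria of the previous files put `p` in `𝒦(P)` resp. `𝒦(P) ⊔ ⟨√c ∩ C(g)⟩`.

## References
* [Pohlmann1968] H. Pohlmann, Algebraic cycles on abelian varieties of complex multiplication type, Ann. of Math. 88 (1968), Thm 1.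
* [Milne1999] J. S. Milne, Lefschetz motives and the Tate conjecture, Compositio Math. 117 (1999), Prop. 2.1, p. 54.
-/

namespace Summit.HodgeConjecture.CorCM.Census.TypeStabiliser

section Twist

variable {G : Type*} [Group G]

/-! ## §1 Small algebra -/

/-- An element of square one has only two powers. [folklore] -/
theorem zpow_eq_zpow_emod_two {x : G} (hx : x * x = 1) (a : ℤ) : x ^ a = x ^ (a % 2) := by
  have hx2 : x ^ (2 : ℤ) = 1 := by rw [zpow_two, hx]
  conv_lhs => rw [← Int.emod_add_mul_ediv a 2, zpow_add, zpow_mul, hx2, one_zpow, mul_one]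

/-- With `g² = z`, `z² = 1`: `g⁴ = 1`. [folklore] -/
theorem zpow_four_eq_one_of_sq {g z : G} (hz : g * g = z) (hz2 : z * z = 1) : g ^ (4 : ℤ) = 1 := by
  have : (4 : ℤ) = 2 + 2 := by norm_num
  rw [this, zpow_add, zpow_two, hz, hz2]

/-- With `g² = z`, `z² = 1`: `gⁱ = g^(i mod 4)`. [folklore] -/
theorem zpow_eq_zpow_emod_four {g z : G} (hz : g * g = z) (hz2 : z * z = 1) (i : ℤ) : g ^ i = g ^ (i % 4) := by
  conv_lhs => rw [← Int.emod_add_mul_ediv i 4, zpow_add, zpow_mul, zpow_four_eq_one_of_sq hz hz2, one_zpow, mul_one]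

/-- With `g² = z`, `z² = 1 ≠ z`: `gⁱ = 1 → 4 ∣ i`. [folklore] -/
theorem four_dvd_of_zpow_eq_one {g z : G} (hz : g * g = z) (hz2 : z * z = 1) (hz1 : z ≠ 1) {i : ℤ} (h : g ^ i = 1) :
    (4 : ℤ) ∣ i := by
  rw [zpow_eq_zpow_emod_four hz hz2] at h
  have hr0 : 0 ≤ i % 4 := by omega
  have hr4 : i % 4 < 4 := by omega
  have key : ∀ r : ℤ, 0 ≤ r → r < 4 → g ^ r = 1 → r = 0 := by
    intro r h0 h4 hr
    interval_cases r
    · rfl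
    · exfalso; apply hz1
      rw [zpow_one] at hr
      rw [← hz, hr, one_mul]
    · exfalso; apply hz1
      rw [zpow_two, hz] at hr
      exact hr
    · exfalso; apply hz1
      have h3 : g ^ (3 : ℤ) = z * g := by
        have : (3 : ℤ) = 2 + 1 := by norm_num
        rw [this, zpow_add, zpow_two, zpow_one, hz]
      rw [h3] at hr
      have hg : g = z := by
        rw [eq_inv_of_mul_eq_one_right hr, inv_eq_of_mul_eq_one_right hz2]
      rw [← hz, hg, hz2]
  have := key (i % 4) hr0 hr4 h
  omega

/-! ## §2 Roots inside a subgroup, and the refined power criteria -/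

/-- `c ∈ ⟨q⟩` in `P` iff `c ∈ ⟨q⟩` in `G`. [folklore] -/
theorem mem_zpowers_subtype_iff (P : Subgroup G) (c q : P) :
    (c : G) ∈ Subgroup.zpowers (q : G) ↔ c ∈ Subgroup.zpowers q := by
  constructor
  · intro h
    obtain ⟨k, hk⟩ := Subgroup.mem_zpowers_iff.mp h
    refine Subgroup.mem_zpowers_iff.mpr ⟨k, Subtype.ext ?_⟩
    rw [Subgroup.coe_zpow, hk]
  · intro h
    obtain ⟨k, hk⟩ := Subgroup.mem_zpowers_iff.mp h
    refine Subgroup.mem_zpowers_iff.mpr ⟨k, ?_⟩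
    rw [← Subgroup.coe_zpow, hk]

/-- `𝒦(P, c) ≤ 𝒦(G, c)` (generatorwise). [folklore] -/
theorem map_subtype_stabGen_le (P : Subgroup G) (c : P) :
    (stabGen c).map P.subtype ≤ stabGen (c : G) := by
  rw [stabGen, MonoidHom.map_closure, Subgroup.closure_le]
  rintro x ⟨q, hq, rfl⟩
  rcases hq with hq | hq
  · rw [Set.mem_singleton_iff] at hq
    rw [hq]
    exact self_mem_stabGen _
  · exact mem_stabGen_of_notMem_zpowers _ fun h => hq ((mem_zpowers_subtype_iff P c q).mp h)

/-- The second-power criterion: `c ∉ ⟨p²⟩ ⇒ p ∈ 𝒦` (a root `q` of `c` with `q² = 1` is `c` itself). [folklore] -/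
theorem mem_stabGen_of_notMem_zpowers_sq {H : Type*} [Group H] (c : H) (hc2 : c * c = 1) (hc1 : c ≠ 1) {p : H}
    (hp : c ∉ Subgroup.zpowers (p ^ (2 : ℤ))) : p ∈ stabGen c := by
  have e : p ^ (2 ^ 1) = p ^ (2 : ℤ) := by rw [pow_one, zpow_two, pow_two]
  have hp' : c ∉ Subgroup.zpowers (p ^ (2 ^ 1)) := by rwa [e]
  have h := mem_sup_roots_of_notMem_zpowers_pow c hc2 hc1 1 hp'
  have hle : Subgroup.closure {q : H | q ^ (2 ^ 1) = 1 ∧ c ∈ Subgroup.zpowers q} ≤ stabGen c := by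
    rw [Subgroup.closure_le]
    rintro q ⟨hq1, hq2⟩
    rw [pow_one, pow_two] at hq1
    obtain ⟨k, hk⟩ := Subgroup.mem_zpowers_iff.mp hq2
    rw [zpow_eq_zpow_emod_two hq1] at hk
    rcases Int.emod_two_eq_zero_or_one k with h0 | h1
    · exfalso; apply hc1; rw [← hk, h0, zpow_zero]
    · rw [h1, zpow_one] at hk
      rw [SetLike.mem_coe, hk]
      exact self_mem_stabGen c
  exact sup_le le_rfl hle h

/-- The refined fourth-power criterion: if `c ∉ ⟨p⁴⟩` and `p` has a property `C` inherited by powers, then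
`p ∈ 𝒦 ⊔ ⟨{q | q² = c, C q}⟩` (the square root produced by the fourth-power criterion is a power of `p`). [folklore] -/
theorem mem_sup_sqrt_prop_of_notMem_zpowers_pow_four {H : Type*} [Group H] (c : H) (hc2 : c * c = 1) (hc1 : c ≠ 1)
    (C : H → Prop) (hC : ∀ q : H, ∀ n : ℤ, C q → C (q ^ n)) {p : H} (hp : c ∉ Subgroup.zpowers (p ^ (4 : ℤ))) (hCp : C p) :
    p ∈ stabGen c ⊔ Subgroup.closure {q : H | q * q = c ∧ C q} := by
  by_cases h : c ∈ Subgroup.zpowers p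
  swap
  · exact Subgroup.mem_sup_left (mem_stabGen_of_notMem_zpowers c h)
  obtain ⟨k, hk⟩ := Subgroup.mem_zpowers_iff.mp h
  have h4 : k = 4 * (k / 4) + k % 4 := by omega
  have hr0 : 0 ≤ k % 4 := by omega
  have hr4 : k % 4 < 4 := by omega
  set m := k / 4 with hm
  set r := k % 4 with hr
  have hodd : ∀ j : ℤ, k = 2 * j + 1 → p ∈ stabGen c ⊔ Subgroup.closure {q : H | q * q = c ∧ C q} := by
    intro j hj
    apply Subgroup.mem_sup_left
    have hsq : (p ^ (2 : ℤ)) ^ k = 1 := by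
      rw [← zpow_mul, mul_comm, zpow_mul, hk, zpow_two, hc2]
    have h2 : p ^ (2 : ℤ) ∈ stabGen c := mem_stabGen_of_zpow_odd c hc2 hc1 ⟨j, hj⟩ hsq
    have hp1 : p = c * (p ^ (2 : ℤ)) ^ (-j) := by
      rw [← hk, ← zpow_mul, ← zpow_add, hj]
      have : 2 * j + 1 + 2 * -j = 1 := by ring
      rw [this, zpow_one]
    rw [hp1]
    exact Subgroup.mul_mem _ (self_mem_stabGen c) (Subgroup.zpow_mem _ h2 _)
  interval_cases hrr : r
  · exfalso
    apply hp
    refine Subgroup.mem_zpowers_iff.mpr ⟨m, ?_⟩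
    rw [← zpow_mul, ← hk, h4]
    congr 1
    omega
  · exact hodd (2 * m) (by omega)
  · have hkm : k = 2 * (2 * m + 1) := by omega
    have hq : p ^ (2 * m + 1) * p ^ (2 * m + 1) = c := by
      rw [← zpow_add, ← hk, hkm]; congr 1; ring
    have hq' : p ^ (2 * m + 1) ∈ stabGen c ⊔ Subgroup.closure {q : H | q * q = c ∧ C q} :=
      Subgroup.mem_sup_right (Subgroup.subset_closure ⟨hq, hC p _ hCp⟩)
    have hb : (p ^ (4 : ℤ)) ^ (2 * m + 1) = 1 := by
      rw [← zpow_mul]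
      have : (4 : ℤ) * (2 * m + 1) = k + k := by omega
      rw [this, zpow_add, hk, hc2]
    have hb' : p ^ (4 : ℤ) ∈ stabGen c ⊔ Subgroup.closure {q : H | q * q = c ∧ C q} :=
      Subgroup.mem_sup_left (mem_stabGen_of_zpow_odd c hc2 hc1 ⟨m, rfl⟩ hb)
    have hp1 : p = (p ^ (2 * m + 1)) ^ (2 * m + 1) * (p ^ (4 : ℤ)) ^ (-(m ^ 2 + m)) := by
      rw [← zpow_mul, ← zpow_mul, ← zpow_add]
      have : (2 * m + 1) * (2 * m + 1) + 4 * -(m ^ 2 + m) = 1 := by ring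
      rw [this, zpow_one]
    rw [hp1]
    exact Subgroup.mul_mem _ (Subgroup.zpow_mem _ hq' _) (Subgroup.zpow_mem _ hb' _)
  · exact hodd (2 * m + 1) (by omega)

/-! ## §3 The twisted law -/

/-- Squares of `p g`: `(p g)² = p (g p g⁻¹) z`. [folklore] -/
theorem mul_sq_eq_of_sq {g z : G} (hz : g * g = z) (p : G) :
    (p * g) ^ (2 : ℤ) = p * (g * p * g⁻¹) * z := by
  rw [zpow_two]
  calc p * g * (p * g) = p * (g * p * g⁻¹) * (g * g) := by group
    _ = p * (g * p * g⁻¹) * z := by rw [hz]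

/-- **THE TWISTED LAW (Proposition Λ).**  Hypotheses as in the module docstring; conclusion: `𝒦(G,c)` for `G = P·⟨g⟩`. [folklore] -/
theorem stabGen_eq_of_twist (P : Subgroup G) (c : P) (g z : G) (hc2 : (c : G) * c = 1) (hc1 : (c : G) ≠ 1)
    (hz : g * g = z) (hzc : z ∈ Subgroup.center G) (hz2 : z * z = 1) (hz1 : z ≠ 1)
    (htwist : ∀ p ∈ P, g * p * g⁻¹ = p ∨ g * p * g⁻¹ = p * z)
    (hnf : ∀ x : G, ∃ p ∈ P, ∃ i : ℤ, x = p * g ^ i)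
    (hind : ∀ p ∈ P, ∀ i : ℤ, p * g ^ i = 1 → g ^ i = 1) :
    stabGen (c : G) =
      (stabGen c ⊔ Subgroup.closure {q : P | q * q = c ∧ Commute g (q : G)}).map P.subtype ⊔ Subgroup.zpowers g := by
  have hzx : ∀ x : G, z * x = x * z := fun x => (Subgroup.mem_center_iff.mp hzc x).symm
  have hc2P : c * c = 1 := Subtype.ext hc2
  have hc1P : c ≠ 1 := fun h => hc1 (by rw [h]; rfl)
  -- `g` is not a root of `c`
  have hgK : (c : G) ∉ Subgroup.zpowers g := by
    intro h
    obtain ⟨i, hi⟩ := Subgroup.mem_zpowers_iff.mp h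
    have h1 : ((c⁻¹ : P) : G) * g ^ i = 1 := by rw [hi, Subgroup.coe_inv, inv_mul_cancel]
    have := hind _ (c⁻¹).2 i h1
    rw [this] at hi
    exact hc1 hi.symm
  -- `q g` is not a root of `c` when `q² = c` and `g q = q g`
  have hqgK : ∀ q : P, q * q = c → Commute g (q : G) → (c : G) ∉ Subgroup.zpowers ((q : G) * g) := by
    intro q hqP hgq h
    have hq : (q : G) * q = c := by rw [← Subgroup.coe_mul, hqP]
    obtain ⟨n, hn⟩ := Subgroup.mem_zpowers_iff.mp h
    have hsq : ((q : G) * g) ^ (2 : ℤ) = c * z := by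
      rw [zpow_two, mul_assoc, ← mul_assoc g (q : G), hgq.eq, mul_assoc, hz, ← mul_assoc, hq]
    have hcz : Commute (c : G) z := (hzx c).symm
    have hcq : Commute (c : G) q := by rw [← hq]; exact (Commute.refl _).mul_left (Commute.refl _)
    have hcg : Commute (c : G) g := by rw [← hq]; exact hgq.symm.mul_left hgq.symm
    have hn2 : n = n % 2 + 2 * (n / 2) := by omega
    rw [hn2, zpow_add, zpow_mul, hsq, hcz.mul_zpow, zpow_eq_zpow_emod_two hc2 (n / 2),
      zpow_eq_zpow_emod_two hz2 (n / 2)] at hn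
    rcases Int.emod_two_eq_zero_or_one n with h0 | h1
    · rw [h0, zpow_zero, one_mul] at hn
      rcases Int.emod_two_eq_zero_or_one (n / 2) with ha0 | ha1
      · apply hc1
        rw [ha0, zpow_zero, zpow_zero, one_mul] at hn
        exact hn.symm
      · apply hz1
        rw [ha1, zpow_one, zpow_one] at hn
        have := congrArg (fun t => ((c : G))⁻¹ * t) hn
        simpa using this
    · rw [h1, zpow_one] at hn
      rcases Int.emod_two_eq_zero_or_one (n / 2) with ha0 | ha1
      · rw [ha0, zpow_zero, zpow_zero, mul_one, mul_one] at hn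
        have h1' : ((c⁻¹ * q : P) : G) * g ^ (1 : ℤ) = 1 := by
          rw [zpow_one, Subgroup.coe_mul, Subgroup.coe_inv, mul_assoc, hn, inv_mul_cancel]
        have := four_dvd_of_zpow_eq_one hz hz2 hz1 (hind _ (c⁻¹ * q).2 1 h1')
        omega
      · rw [ha1, zpow_one, zpow_one] at hn
        have hcomm : Commute (c : G) ((q : G) * g) := hcq.mul_right hcg
        have h' : (c : G) * ((q : G) * (g * z)) = (c : G) * 1 := by
          rw [mul_one]
          calc (c : G) * ((q : G) * (g * z)) = (c : G) * ((q : G) * g) * z := by group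
            _ = (q : G) * g * (c : G) * z := by rw [hcomm.eq]
            _ = (q : G) * g * ((c : G) * z) := by group
            _ = c := hn
        have key : (q : G) * (g * z) = 1 := mul_left_cancel h'
        have h3 : g ^ (3 : ℤ) = g * z := by
          have : (3 : ℤ) = 1 + 2 := by norm_num
          rw [this, zpow_add, zpow_one, zpow_two, hz]
        have := four_dvd_of_zpow_eq_one hz hz2 hz1 (hind _ q.2 3 (by rw [h3, key]))
        omega
  -- the right-hand side, abbreviated
  set R := (stabGen c ⊔ Subgroup.closure {q : P | q * q = c ∧ Commute g (q : G)}).map P.subtype ⊔ Subgroup.zpowers g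
    with hR
  apply le_antisymm
  · rw [stabGen_le_iff_subset]
    refine ⟨Subgroup.mem_sup_left (Subgroup.mem_map.mpr ⟨c, Subgroup.mem_sup_left (self_mem_stabGen c), rfl⟩), ?_⟩
    intro x hx
    obtain ⟨p, hpP, i, rfl⟩ := hnf x
    rw [zpow_eq_zpow_emod_four hz hz2 i] at hx ⊢
    have hr0 : 0 ≤ i % 4 := by omega
    have hr4 : i % 4 < 4 := by omega
    have hgi : g ^ (i % 4) ∈ R := Subgroup.mem_sup_right (Subgroup.zpow_mem _ (Subgroup.mem_zpowers g) _)
    -- it suffices to place `p`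
    suffices hp : p ∈ (stabGen c ⊔ Subgroup.closure {q : P | q * q = c ∧ Commute g (q : G)}).map P.subtype from
      Subgroup.mul_mem _ (Subgroup.mem_sup_left hp) hgi
    set p' : P := ⟨p, hpP⟩ with hp'
    have hpp : (p' : G) = p := rfl
    -- tool (E): if x² = p² then c ∉ ⟨p²⟩ and p ∈ 𝒦(P)
    have toolE : (p * g ^ (i % 4)) ^ (2 : ℤ) = p ^ (2 : ℤ) →
        p ∈ (stabGen c ⊔ Subgroup.closure {q : P | q * q = c ∧ Commute g (q : G)}).map P.subtype := by
      intro hsq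
      have hnot : (c : G) ∉ Subgroup.zpowers (p ^ (2 : ℤ)) := by
        intro hc
        apply hx
        obtain ⟨m, hm⟩ := Subgroup.mem_zpowers_iff.mp hc
        refine Subgroup.mem_zpowers_iff.mpr ⟨2 * m, ?_⟩
        rw [zpow_mul, hsq, hm]
      have hnotP : c ∉ Subgroup.zpowers (p' ^ (2 : ℤ)) := by
        intro hc
        apply hnot
        have := (mem_zpowers_subtype_iff P c (p' ^ (2 : ℤ))).mpr hc
        rwa [Subgroup.coe_zpow] at this
      have hmem : p' ∈ stabGen c := mem_stabGen_of_notMem_zpowers_sq c hc2P hc1P hnotP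
      exact Subgroup.mem_map.mpr ⟨p', Subgroup.mem_sup_left hmem, rfl⟩
    -- tool (O): if x⁴ = p⁴ and g p = p g then c ∉ ⟨p⁴⟩ and p ∈ 𝒦(P) ⊔ ⟨√c ∩ C(g)⟩
    have toolO : (p * g ^ (i % 4)) ^ (4 : ℤ) = p ^ (4 : ℤ) → Commute g p →
        p ∈ (stabGen c ⊔ Subgroup.closure {q : P | q * q = c ∧ Commute g (q : G)}).map P.subtype := by
      intro h4 hgp
      have hnot : (c : G) ∉ Subgroup.zpowers (p ^ (4 : ℤ)) := by
        intro hc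
        apply hx
        obtain ⟨m, hm⟩ := Subgroup.mem_zpowers_iff.mp hc
        refine Subgroup.mem_zpowers_iff.mpr ⟨4 * m, ?_⟩
        rw [zpow_mul, h4, hm]
      have hnotP : c ∉ Subgroup.zpowers (p' ^ (4 : ℤ)) := by
        intro hc
        apply hnot
        have := (mem_zpowers_subtype_iff P c (p' ^ (4 : ℤ))).mpr hc
        rwa [Subgroup.coe_zpow] at this
      have hmem := mem_sup_sqrt_prop_of_notMem_zpowers_pow_four c hc2P hc1P (fun q : P => Commute g (q : G))
        (fun q n hq => by rw [Subgroup.coe_zpow]; exact hq.zpow_right n) hnotP hgp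
      exact Subgroup.mem_map.mpr ⟨p', hmem, rfl⟩
    -- squares: (p g)² and (p g³)² = (p g)²
    have hsq1 : (p * g) ^ (2 : ℤ) = p * (g * p * g⁻¹) * z := mul_sq_eq_of_sq hz p
    have hsq3 : (p * g ^ (3 : ℤ)) ^ (2 : ℤ) = p * (g * p * g⁻¹) * z := by
      have h3 : g ^ (3 : ℤ) = g * z := by
        have : (3 : ℤ) = 1 + 2 := by norm_num
        rw [this, zpow_add, zpow_one, zpow_two, hz]
      rw [h3, ← mul_assoc, zpow_two]
      have : p * g * z * (p * g * z) = (p * g) * (p * g) * (z * z) := by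
        calc p * g * z * (p * g * z) = p * g * (z * (p * g * z)) := by group
          _ = p * g * ((p * g * z) * z) := by rw [hzx]
          _ = (p * g) * (p * g) * (z * z) := by group
      rw [this, hz2, mul_one, ← zpow_two, hsq1]
    -- the case split on i mod 4
    set r := i % 4 with hr
    -- central bookkeeping
    have hppz : p * p * z * (p * p * z) = p * p * (p * p) := by
      calc p * p * z * (p * p * z) = p * p * (z * (p * p * z)) := by group
        _ = p * p * ((p * p * z) * z) := by rw [hzx]
        _ = p * p * (p * p) * (z * z) := by group
        _ = p * p * (p * p) := by rw [hz2, mul_one]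
    have hpzz : p * (p * z) * z = p * p := by
      calc p * (p * z) * z = p * p * (z * z) := by group
        _ = p * p := by rw [hz2, mul_one]
    have hpz : p * z * (p * z) = p * p := by
      calc p * z * (p * z) = p * (z * (p * z)) := by group
        _ = p * ((p * z) * z) := by rw [hzx]
        _ = p * p * (z * z) := by group
        _ = p * p := by rw [hz2, mul_one]
    have hp2 : p ^ (2 : ℤ) = p * p := zpow_two p
    have hp4 : p ^ (4 : ℤ) = p * p * (p * p) := by
      have : (4 : ℤ) = 2 + 2 := by norm_num
      rw [this, zpow_add, zpow_two]
    have hgp_of : g * p * g⁻¹ = p → Commute g p := by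
      intro h0
      have h' : g * p = p * g := by
        have := congrArg (· * g) h0
        simpa using this
      exact h'
    interval_cases hrr : r
    · apply toolE; rw [zpow_zero, mul_one]
    · rcases htwist p hpP with h0 | h1
      · -- λ = 0: x⁴ = p⁴
        apply toolO _ (hgp_of h0)
        have hx2 : (p * g ^ (1 : ℤ)) ^ (2 : ℤ) = p * p * z := by rw [zpow_one, hsq1, h0]
        have e4 : (4 : ℤ) = 2 * 2 := by norm_num
        rw [hp4, e4, zpow_mul, hx2, zpow_two, hppz]
      · apply toolE
        rw [zpow_one, hsq1, h1, hp2, hpzz]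
    · apply toolE
      have hg2 : g ^ (2 : ℤ) = z := by rw [zpow_two, hz]
      rw [hg2, hp2, zpow_two, hpz]
    · rcases htwist p hpP with h0 | h1
      · apply toolO _ (hgp_of h0)
        have hx2 : (p * g ^ (3 : ℤ)) ^ (2 : ℤ) = p * p * z := by rw [hsq3, h0]
        have e4 : (4 : ℤ) = 2 * 2 := by norm_num
        rw [hp4, e4, zpow_mul, hx2, zpow_two, hppz]
      · apply toolE
        rw [hsq3, h1, hp2, hpzz]
  · refine sup_le ?_ ((Subgroup.zpowers_le).mpr (mem_stabGen_of_notMem_zpowers _ hgK))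
    rw [Subgroup.map_sup, sup_le_iff, MonoidHom.map_closure, Subgroup.closure_le]
    refine ⟨map_subtype_stabGen_le P c, ?_⟩
    rintro x ⟨q, ⟨hq, hgq⟩, rfl⟩
    have h1 : (q : G) * g ∈ stabGen (c : G) := mem_stabGen_of_notMem_zpowers _ (hqgK q hq hgq)
    have h2 : g ∈ stabGen (c : G) := mem_stabGen_of_notMem_zpowers _ hgK
    have : P.subtype q = (q : G) * g * g⁻¹ := by rw [mul_inv_cancel_right]; rfl
    rw [this]
    exact Subgroup.mul_mem _ h1 (Subgroup.inv_mem _ h2)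

end Twist

end Summit.HodgeConjecture.CorCM.Census.TypeStabiliser
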